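import Summits.Schanuel.Schanuel.Theorems.RootDecomp1BDefectFloorCells

/-!
# RootDecomp1BDefectFloorCellsPi — the (γ) INSTANCES of the defect floor (lens 4 gen 9, node `DefectFloor` §Gen 9,
# «THE FIRST OPEN CELLS OF THE FLOOR ARE THREE-NUMBER STATEMENTS»; critic VERDICT 2026-08-30T11:13:26Z C5: «because (γ)
# is credited — port the (γ) instances too»)

* `sharpRelativeLindemannAt_one_pi_iff` — FLAG (1 ∣ π): every structural hypothesis is a theorem
  (`linearIndependent_one_pi`, `polarDeg_one_le_two`), so the floor there is EXACTLY «KleinIH 2 → t(1, π) ≥ 3»;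
  `three_le_polarDeg_one_pi_of_e` / `three_le_polarDeg_one_pi_of_exp_I`: it follows from «π, e^π, e algebraically
  independent» or from «π, e^π, e^i algebraically independent» (three numbers; X at (1, π) asks for four).
* `sharpRelativeLindemannAt_piExpPi_iff` (mod the tree's named fact `nesterenko`, which makes (π, e^π) `ℚ`-free) —
  FLAG (π ∣ e^π): the floor is EXACTLY «KleinIH 2 → t(π, e^π) ≥ 3»; `three_le_polarDeg_piExpPi_of`: it follows from
  «π, e^π, e^{e^π} algebraically independent».

Extracted mechanically (dependency closure, 27 declarations in node order) from
HOME/decomp-schanuel-lens-4/g9/DefectFloor.lean (sha256 a9054e8c…); the polar-flag bookkeeping it needs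
(`polarField_succ`, `polarDeg_le_init_add_of_algebraic`, `polarDeg_le_init_add_two_of_lastFed`, `polarDeg_fin_zero`, …)
is node-proper round-7 material not previously landed. Same namespace as `RootDecomp1BDefectFloorCells`; identical twins
of landed `RootDecomp1BFedFlag{Defs,Core}` / `RootDecomp1BTameFlag{Defs,Core,Steps}` declarations are `open`ed, not
restated; sorry-free; standard axioms.
-/

open Complex IntermediateField
open Literature.NumberTheory.Transcendental (trdeg_adjoin_le_of_le isAlgebraic_adjoin_over_algebraAdjoin nesterenko)

namespace Summit.Schanuel.Schanuel.Theorems.RootDecomp1BDefectFloorCells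

set_option linter.dupNamespace false

open Summit.Schanuel.Schanuel.Theorems.RootDecomp1BFedFlagCore
open Summit.Schanuel.Schanuel.Theorems.RootDecomp1BTameFlagCore
open Summit.Schanuel.Schanuel.Theorems.RootDecomp1BDefectFloorDefs

section

variable {m : ℕ}

/-- (private copy; landed twins in other cones) Monotonicity of transcendence degree under inclusion of generators. [folklore] -/
private theorem trdeg_adjoin_mono {S T : Set ℂ} (h : S ⊆ T) :
    Algebra.trdeg ℚ ↥(IntermediateField.adjoin ℚ S) ≤ Algebra.trdeg ℚ ↥(IntermediateField.adjoin ℚ T) :=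
  trdeg_le_of_injective (IntermediateField.inclusion (IntermediateField.adjoin.mono ℚ S T h))
    (IntermediateField.inclusion_injective _)

/-- (private copy; a landed twin exists in another cone) `T` algebraic over `K` ⟹ `trdeg_ℚ ℚ(T) ≤ trdeg_ℚ K`. [folklore; lens-2 `DefectLattice.trdeg_adjoin_le_of_isAlgebraic`] -/
private theorem trdeg_adjoin_le_of_isAlgebraic (K : IntermediateField ℚ ℂ) {T : Set ℂ}
    (hT : ∀ x ∈ T, IsAlgebraic K x) :
    Algebra.trdeg ℚ ↥(adjoin ℚ T) ≤ Algebra.trdeg ℚ ↥K := by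
  have hmono : Algebra.trdeg ℚ ↥(adjoin ℚ T) ≤ Algebra.trdeg ℚ ↥(adjoin ℚ ((K : Set ℂ) ∪ T)) :=
    trdeg_adjoin_mono Set.subset_union_right
  refine hmono.trans (le_of_eq ?_)
  haveI : Algebra.IsAlgebraic K (adjoin K T) :=
    isAlgebraic_adjoin fun x hx => (hT x hx).isIntegral
  have h := trdeg_add_eq ℚ K (A := adjoin K T)
  rw [trdeg_eq_zero (R := K) (A := adjoin K T), add_zero] at h
  have e := (equivOfEq (restrictScalars_adjoin ℚ K T)).symm.trdeg_eq
  calc Algebra.trdeg ℚ ↥(adjoin ℚ ((K : Set ℂ) ∪ T))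
      = Algebra.trdeg ℚ ↥((adjoin K T).restrictScalars ℚ) := e
    _ = Algebra.trdeg ℚ ↥(adjoin K T) := rfl
    _ = Algebra.trdeg ℚ ↥K := h.symm

/-- (private copy; a landed twin exists in another cone) Elements of the generating set are algebraic over the generated field. [lens-2] -/
private theorem isAlgebraic_of_mem_gens {S : Set ℂ} {x : ℂ} (hx : x ∈ S) :
    IsAlgebraic ↥(adjoin ℚ S) x := by
  have hx' : x ∈ adjoin ℚ S := subset_adjoin ℚ S hx
  exact isAlgebraic_algebraMap (⟨x, hx'⟩ : ↥(adjoin ℚ S))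

/-- The flagship pair (π, e^π) of gen 5 (base rank 2 PROVED: Nesterenko). -/
noncomputable def piExpPi : Fin 2 → ℝ := ![Real.pi, Real.exp Real.pi]

/-- The four generators contributed by the LAST coordinate `u = r (Fin.last m)`: `u, u i, e^u, e^{u i}`. -/
def lastGens {m : ℕ} (r : Fin (m + 1) → ℝ) : Set ℂ :=
  {((r (Fin.last m) : ℝ) : ℂ), ((r (Fin.last m) : ℝ) : ℂ) * Complex.I, Complex.exp ((r (Fin.last m) : ℝ) : ℂ),
    Complex.exp (((r (Fin.last m) : ℝ) : ℂ) * Complex.I)}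

/-- The modulus side sits inside the polar tuple. -/
theorem range_real_subset_polar {m : ℕ} (r : Fin m → ℝ) :
    Set.range (fun j => ((r j : ℝ) : ℂ)) ⊆
      Set.range (Fin.append (fun j => ((r j : ℝ) : ℂ)) (fun j => ((r j : ℝ) : ℂ) * Complex.I)) := by
  rintro _ ⟨j, rfl⟩
  exact ⟨Fin.castAdd m j, by simp only [Fin.append_left]⟩

/-- `e^{iπ} = −1` is algebraic. -/
theorem isAlgebraic_exp_pi_mul_I : IsAlgebraic ℚ (Complex.exp (((Real.pi : ℝ) : ℂ) * Complex.I)) := by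
  rw [Complex.exp_pi_mul_I]
  exact isAlgebraic_one.neg

/-- … and is in particular `ℚ`-free. -/
theorem linearIndependent_of_algebraicIndependent {m : ℕ} {r : Fin m → ℝ} (h : AlgebraicIndependent ℚ r) :
    LinearIndependent ℚ r :=
  h.linearIndependent

/-- Its first two coordinates: π and e^π are algebraically independent over ℚ. -/
theorem algebraicIndependent_piExpPi (hN : nesterenko) : AlgebraicIndependent ℚ piExpPi := by
  have h := (algebraicIndependent_piExpPiGamma hN).comp ![(0 : Fin 3), 1] (by decide)
  convert h using 1
  funext i
  fin_cases i <;> rfl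

/-- (π, e^π) is `ℚ`-free (mod `nesterenko`). -/
theorem linearIndependent_piExpPi (hN : nesterenko) : LinearIndependent ℚ piExpPi :=
  linearIndependent_of_algebraicIndependent (algebraicIndependent_piExpPi hN)

/-- `range (Fin.append f g) = range f ∪ range g`. -/
theorem range_append_eq {α : Type*} {a b : ℕ} (f : Fin a → α) (g : Fin b → α) :
    Set.range (Fin.append f g) = Set.range f ∪ Set.range g := by
  refine Set.Subset.antisymm (range_append_subset f g) (Set.union_subset ?_ ?_)
  · rintro _ ⟨j, rfl⟩
    exact ⟨Fin.castAdd b j, by simp only [Fin.append_left]⟩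
  · rintro _ ⟨j, rfl⟩
    exact ⟨Fin.natAdd a j, by simp only [Fin.append_right]⟩

/-- the real-generator tuple of `r` is `Fin.snoc` of that of `Fin.init r` and the last coordinate. -/
theorem re_eq_snoc (r : Fin (m + 1) → ℝ) :
    (fun j => ((r j : ℝ) : ℂ)) = Fin.snoc (fun j => ((Fin.init r j : ℝ) : ℂ)) (((r (Fin.last m) : ℝ) : ℂ)) := by
  funext j
  refine Fin.lastCases ?_ (fun i => ?_) j
  · simp only [Fin.snoc_last]
  · simp only [Fin.snoc_castSucc]
    rfl

/-- the imaginary-generator tuple of `r` is `Fin.snoc` of that of `Fin.init r` and `i·u`. -/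
theorem im_eq_snoc (r : Fin (m + 1) → ℝ) :
    (fun j => ((r j : ℝ) : ℂ) * Complex.I) =
      Fin.snoc (fun j => ((Fin.init r j : ℝ) : ℂ) * Complex.I) (((r (Fin.last m) : ℝ) : ℂ) * Complex.I) := by
  funext j
  refine Fin.lastCases ?_ (fun i => ?_) j
  · simp only [Fin.snoc_last]
  · simp only [Fin.snoc_castSucc]
    rfl

/-- real generators of `r` = those of `Fin.init r` plus the last coordinate. -/
theorem range_re_succ (r : Fin (m + 1) → ℝ) :
    Set.range (fun j => ((r j : ℝ) : ℂ)) =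
      insert (((r (Fin.last m) : ℝ) : ℂ)) (Set.range (fun j => ((Fin.init r j : ℝ) : ℂ))) := by
  rw [re_eq_snoc, Fin.range_snoc]

/-- imaginary generators of `r` = those of `Fin.init r` plus `i·u`. -/
theorem range_im_succ (r : Fin (m + 1) → ℝ) :
    Set.range (fun j => ((r j : ℝ) : ℂ) * Complex.I) =
      insert (((r (Fin.last m) : ℝ) : ℂ) * Complex.I) (Set.range (fun j => ((Fin.init r j : ℝ) : ℂ) * Complex.I)) := by
  rw [im_eq_snoc, Fin.range_snoc]

/-- The polar generators of `r` = those of the hyperplane `Fin.init r` ∪ the four of the last coordinate. -/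
theorem polarGens_succ (r : Fin (m + 1) → ℝ) : polarGens r = polarGens (Fin.init r) ∪ lastGens r := by
  simp only [polarGens, lastGens, Set.range_comp, range_append_eq, range_re_succ r, range_im_succ r, Set.image_union,
    Set.image_insert_eq]
  ext x
  simp only [Set.mem_union, Set.mem_insert_iff, Set.mem_singleton_iff]
  tauto

/-- the polar field of `r` is the polar field of `Fin.init r` with `u, iu, e^u, e^{iu}` adjoined. -/
theorem polarField_succ (r : Fin (m + 1) → ℝ) :
    polarField r = IntermediateField.adjoin ℚ (polarGens (Fin.init r) ∪ lastGens r) := by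
  rw [polarField_eq_adjoin, polarGens_succ]

set_option synthInstance.maxHeartbeats 200000 in

/-- the base field `B(r)` sits inside `ℚ(F(r')-generators ∪ T)` as soon as `u ∈ T`. -/
theorem baseField_le_adjoin_init_union (r : Fin (m + 1) → ℝ) (T : Set ℂ) (hu : ((r (Fin.last m) : ℝ) : ℂ) ∈ T) :
    baseField r ≤ IntermediateField.adjoin ℚ (polarGens (Fin.init r) ∪ T) := by
  change IntermediateField.adjoin ℚ _ ≤ _
  refine adjoin.mono ℚ _ _ ?_
  rw [range_re_succ]
  rintro x (rfl | ⟨j, rfl⟩)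
  · exact Or.inr hu
  · exact Or.inl (Or.inl ((range_real_subset_polar (Fin.init r)) ⟨j, rfl⟩))

set_option synthInstance.maxHeartbeats 200000 in

/-- `t(r) ≤ t(r') + #T` whenever the four last generators are algebraic over `ℚ(F(r')-generators ∪ T)`. -/
theorem polarDeg_le_init_add_of_algebraic (r : Fin (m + 1) → ℝ) (T : Set ℂ)
    (halg : ∀ x ∈ lastGens r, IsAlgebraic ↥(IntermediateField.adjoin ℚ (polarGens (Fin.init r) ∪ T)) x) :
    polarDeg r ≤ polarDeg (Fin.init r) + Cardinal.mk T := by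
  have hK : ∀ x ∈ polarGens (Fin.init r) ∪ lastGens r,
      IsAlgebraic ↥(IntermediateField.adjoin ℚ (polarGens (Fin.init r) ∪ T)) x := by
    rintro x (hx | hx)
    · exact isAlgebraic_of_mem_gens (Or.inl hx)
    · exact halg x hx
  calc polarDeg r
      = Algebra.trdeg ℚ ↥(IntermediateField.adjoin ℚ (polarGens (Fin.init r) ∪ lastGens r)) :=
        (equivOfEq (polarField_succ r)).trdeg_eq
    _ ≤ Algebra.trdeg ℚ ↥(IntermediateField.adjoin ℚ (polarGens (Fin.init r) ∪ T)) :=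
        trdeg_adjoin_le_of_isAlgebraic _ hK
    _ ≤ Algebra.trdeg ℚ ↥(IntermediateField.adjoin ℚ (polarGens (Fin.init r))) + Cardinal.mk T :=
        trdeg_union_le_add_mk _ _
    _ = polarDeg (Fin.init r) + Cardinal.mk T := rfl

/-- A FED last coordinate adds at most TWO: the fed exponential is algebraic over `B(r) ≤ ℚ(F(r')-gens, u)`. -/
theorem polarDeg_le_init_add_two_of_lastFed (r : Fin (m + 1) → ℝ) (hfed : LastFed m r) :
    polarDeg r ≤ polarDeg (Fin.init r) + ((2 : ℕ) : Cardinal) := by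
  rcases hfed with hM | hΦ
  · have h := polarDeg_le_init_add_of_algebraic r
      (Set.range ![((r (Fin.last m) : ℝ) : ℂ), Complex.exp (((r (Fin.last m) : ℝ) : ℂ) * Complex.I)]) ?_
    · exact h.trans (add_le_add le_rfl (Cardinal.mk_range_le.trans (by simp)))
    · have hK : ∀ y ∈ Set.range ![((r (Fin.last m) : ℝ) : ℂ), Complex.exp (((r (Fin.last m) : ℝ) : ℂ) * Complex.I)],
          IsAlgebraic ↥(IntermediateField.adjoin ℚ (polarGens (Fin.init r) ∪
            Set.range ![((r (Fin.last m) : ℝ) : ℂ), Complex.exp (((r (Fin.last m) : ℝ) : ℂ) * Complex.I)])) y :=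
        fun y hy => isAlgebraic_of_mem_gens (Or.inr hy)
      have hB := baseField_le_adjoin_init_union r
        (Set.range ![((r (Fin.last m) : ℝ) : ℂ), Complex.exp (((r (Fin.last m) : ℝ) : ℂ) * Complex.I)]) ⟨0, rfl⟩
      intro x hx
      simp only [lastGens, Set.mem_insert_iff, Set.mem_singleton_iff] at hx
      rcases hx with rfl | rfl | rfl | rfl
      · exact hK _ ⟨0, rfl⟩
      · exact (hK _ ⟨0, rfl⟩).mul (isAlgebraic_I _)
      · exact isAlgebraic_of_le hB hM
      · exact hK _ ⟨1, rfl⟩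
  · have h := polarDeg_le_init_add_of_algebraic r
      (Set.range ![((r (Fin.last m) : ℝ) : ℂ), Complex.exp ((r (Fin.last m) : ℝ) : ℂ)]) ?_
    · exact h.trans (add_le_add le_rfl (Cardinal.mk_range_le.trans (by simp)))
    · have hK : ∀ y ∈ Set.range ![((r (Fin.last m) : ℝ) : ℂ), Complex.exp ((r (Fin.last m) : ℝ) : ℂ)],
          IsAlgebraic ↥(IntermediateField.adjoin ℚ (polarGens (Fin.init r) ∪
            Set.range ![((r (Fin.last m) : ℝ) : ℂ), Complex.exp ((r (Fin.last m) : ℝ) : ℂ)])) y :=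
        fun y hy => isAlgebraic_of_mem_gens (Or.inr hy)
      have hB := baseField_le_adjoin_init_union r
        (Set.range ![((r (Fin.last m) : ℝ) : ℂ), Complex.exp ((r (Fin.last m) : ℝ) : ℂ)]) ⟨0, rfl⟩
      intro x hx
      simp only [lastGens, Set.mem_insert_iff, Set.mem_singleton_iff] at hx
      rcases hx with rfl | rfl | rfl | rfl
      · exact hK _ ⟨0, rfl⟩
      · exact (hK _ ⟨0, rfl⟩).mul (isAlgebraic_I _)
      · exact hK _ ⟨1, rfl⟩
      · exact isAlgebraic_of_le hB hΦ

/-- the empty hyperplane has `t = 0` -/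
theorem polarDeg_fin_zero (s : Fin 0 → ℝ) : polarDeg s = 0 := by
  refine le_antisymm ((trdeg_adjoin_le_cardinalMk (F := ℚ) _).trans ?_) bot_le
  refine (Cardinal.mk_union_le _ _).trans ?_
  have h1 : Cardinal.mk ↥(Set.range (Fin.append (fun j => ((s j : ℝ) : ℂ)) (fun j => ((s j : ℝ) : ℂ) * Complex.I))) ≤ 0 :=
    Cardinal.mk_range_le.trans (by simp)
  have h2 : Cardinal.mk ↥(Set.range (Complex.exp ∘
      Fin.append (fun j => ((s j : ℝ) : ℂ)) (fun j => ((s j : ℝ) : ℂ) * Complex.I))) ≤ 0 :=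
    Cardinal.mk_range_le.trans (by simp)
  calc _ ≤ (0 : Cardinal) + 0 := add_le_add h1 h2
    _ = 0 := add_zero 0

/-- `(1, π)` is `ℚ`-free (π is irrational). -/
theorem linearIndependent_one_pi : LinearIndependent ℚ ![(1 : ℝ), Real.pi] := by
  refine Fintype.linearIndependent_iff.mpr fun g hg => ?_
  simp only [Fin.sum_univ_two, Matrix.cons_val_zero, Matrix.cons_val_one, Rat.smul_def, mul_one] at hg
  have h1 : g 1 = 0 := by
    by_contra hne
    have hne' : ((g 1 : ℚ) : ℝ) ≠ 0 := by exact_mod_cast hne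
    refine irrational_pi ⟨-(g 0) / g 1, ?_⟩
    push_cast
    field_simp
    linarith
  have h0 : g 0 = 0 := by
    rw [h1, Rat.cast_zero, zero_mul, add_zero] at hg
    exact_mod_cast hg
  intro i
  fin_cases i
  · exact h0
  · exact h1

/-- `t(1) ≤ 2` (indeed `= 2` by Lindemann–Weierstrass: e, e^i). -/
theorem polarDeg_one_le_two : polarDeg ![(1 : ℝ)] ≤ ((2 : ℕ) : Cardinal) := by
  have hρ : baseDeg ![(1 : ℝ)] = 0 := by
    apply le_antisymm _ bot_le
    haveI : Algebra.IsAlgebraic ℚ ↥(baseField ![(1 : ℝ)]) :=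
      isAlgebraic_adjoin fun x hx => by
        obtain ⟨j, rfl⟩ := hx
        fin_cases j
        simpa using isIntegral_one
    exact (trdeg_eq_zero (R := ℚ) (A := ↥(baseField ![(1 : ℝ)]))).le
  have h1 := modDeg_le_baseDeg_add ![(1 : ℝ)]
  have h2 := phaseDeg_le_baseDeg_add ![(1 : ℝ)]
  have h3 := polarDeg_add_baseDeg_le ![(1 : ℝ)]
  rw [hρ] at h1 h2 h3
  obtain ⟨na, hna⟩ := Cardinal.lt_aleph0.mp (modDeg_lt_aleph0 ![(1 : ℝ)])
  obtain ⟨nb, hnb⟩ := Cardinal.lt_aleph0.mp (phaseDeg_lt_aleph0 ![(1 : ℝ)])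
  obtain ⟨nt, hnt⟩ := Cardinal.lt_aleph0.mp (polarDeg_lt_aleph0 ![(1 : ℝ)])
  rw [hna] at h1 h3
  rw [hnb] at h2 h3
  rw [hnt] at h3 ⊢
  norm_cast at h1 h2 h3 ⊢
  omega

/-- `t(π) ≤ 2`: the line ℚπ is a SHARP hyperplane (π is fed: e^{iπ} = −1). -/
theorem polarDeg_pi_le_two : polarDeg ![Real.pi] ≤ ((2 : ℕ) : Cardinal) := by
  have hlast : ![Real.pi] (Fin.last 0) = Real.pi := rfl
  have hfed : LastFed 0 ![Real.pi] := by
    right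
    rw [hlast]
    exact isAlgebraic_exp_pi_mul_I.tower_top _
  have h := polarDeg_le_init_add_two_of_lastFed ![Real.pi] hfed
  rw [polarDeg_fin_zero] at h
  simpa using h

/-- FLAG (1 | π): every structural hypothesis is a theorem (`linearIndependent_one_pi`, `polarDeg_one_le_two`), so
the floor there is EXACTLY «KleinIH 2 → t(1, π) ≥ 3» (X at (1, π) is «t(1, π) ≥ 4»: e, e^i, π, e^π). -/
theorem sharpRelativeLindemannAt_one_pi_iff :
    SharpRelativeLindemannAt 1 ![(1 : ℝ), Real.pi] ↔
      (KleinIH 2 → ((3 : ℕ) : Cardinal) ≤ polarDeg ![(1 : ℝ), Real.pi]) := by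
  have hinit : Fin.init ![(1 : ℝ), Real.pi] = ![(1 : ℝ)] := by
    funext j
    fin_cases j
    rfl
  have hle : polarDeg (Fin.init ![(1 : ℝ), Real.pi]) ≤ ((1 + 1 : ℕ) : Cardinal) := by
    rw [hinit]
    exact polarDeg_one_le_two
  constructor
  · intro h hIH
    exact_mod_cast h linearIndependent_one_pi hIH hle
  · intro h _ hIH _
    exact_mod_cast h hIH

/-- (1 | π) ⟸ «π, e^π, e algebraically independent» … -/
theorem three_le_polarDeg_one_pi_of_e
    (h : AlgebraicIndependent ℚ
      ![((Real.pi : ℝ) : ℂ), Complex.exp ((Real.pi : ℝ) : ℂ), Complex.exp (((1 : ℝ) : ℝ) : ℂ)]) :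
    ((3 : ℕ) : Cardinal) ≤ polarDeg ![(1 : ℝ), Real.pi] := by
  refine natCast_le_trdeg_of_algebraicIndependent h fun i => ?_
  fin_cases i
  · exact coe_mem_polarField ![(1 : ℝ), Real.pi] 1
  · exact exp_coe_mem_polarField ![(1 : ℝ), Real.pi] 1
  · exact exp_coe_mem_polarField ![(1 : ℝ), Real.pi] 0

/-- … or ⟸ «π, e^π, e^i algebraically independent». -/
theorem three_le_polarDeg_one_pi_of_exp_I
    (h : AlgebraicIndependent ℚ
      ![((Real.pi : ℝ) : ℂ), Complex.exp ((Real.pi : ℝ) : ℂ), Complex.exp ((((1 : ℝ) : ℝ) : ℂ) * Complex.I)]) :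
    ((3 : ℕ) : Cardinal) ≤ polarDeg ![(1 : ℝ), Real.pi] := by
  refine natCast_le_trdeg_of_algebraicIndependent h fun i => ?_
  fin_cases i
  · exact coe_mem_polarField ![(1 : ℝ), Real.pi] 1
  · exact exp_coe_mem_polarField ![(1 : ℝ), Real.pi] 1
  · exact exp_coe_mul_I_mem_polarField ![(1 : ℝ), Real.pi] 0

/-- `Fin.init (π, e^π) = (π)`. -/
theorem init_piExpPi_eq : Fin.init piExpPi = ![Real.pi] := by
  funext j
  fin_cases j
  rfl

/-- FLAG (π | e^π): `ℚ`-free (Nesterenko), (π) sharp; the floor there is EXACTLY «KleinIH 2 → t(π, e^π) ≥ 3» =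
«e^{e^π} or e^{ie^π} is transcendental over ℚ(π, e^π)» (u = e^π ∈ F(π) already) — THREE numbers: OPEN, inside the
ceiling. -/
theorem sharpRelativeLindemannAt_piExpPi_iff (hN : nesterenko) :
    SharpRelativeLindemannAt 1 piExpPi ↔ (KleinIH 2 → ((3 : ℕ) : Cardinal) ≤ polarDeg piExpPi) := by
  have hle : polarDeg (Fin.init piExpPi) ≤ ((1 + 1 : ℕ) : Cardinal) := by
    rw [init_piExpPi_eq]
    exact_mod_cast polarDeg_pi_le_two
  constructor
  · intro h hIH
    exact_mod_cast h (linearIndependent_piExpPi hN) hIH hle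
  · intro h _ hIH _
    exact_mod_cast h hIH

/-- (π | e^π) ⟸ «π, e^π, e^{e^π} algebraically independent» (the three-number statement it contains). -/
theorem three_le_polarDeg_piExpPi_of
    (h : AlgebraicIndependent ℚ
      ![((Real.pi : ℝ) : ℂ), Complex.exp ((Real.pi : ℝ) : ℂ), Complex.exp (((Real.exp Real.pi : ℝ)) : ℂ)]) :
    ((3 : ℕ) : Cardinal) ≤ polarDeg piExpPi := by
  refine natCast_le_trdeg_of_algebraicIndependent h fun i => ?_
  fin_cases i
  · exact coe_mem_polarField piExpPi 0
  · exact exp_coe_mem_polarField piExpPi 0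
  · exact exp_coe_mem_polarField piExpPi 1

end

end Summit.Schanuel.Schanuel.Theorems.RootDecomp1BDefectFloorCells
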